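import Summits.QuantumFields.BalabanUV.T4Continuum.Support.NE3FramePotBound
import Summits.QuantumFields.BalabanUV.T4Continuum.Support.NE3FramePotGauge
import Summits.QuantumFields.BalabanUV.T4Continuum.Support.NE3FrameFreeDecompositionPrep
import Summits.QuantumFields.BalabanUV.T4Continuum.Support.NE3BlockLineAverage
import Summits.QuantumFields.BalabanUV.T4Continuum.Support.NE3BlockPoincareCore
import Summits.QuantumFields.BalabanUV.T4Continuum.Support.NE7ApeFlatSkeleton
import Summits.QuantumFields.BalabanUV.T4Continuum.Support.NE3EnergyHessBilin
import Summits.QuantumFields.BalabanUV.T4Continuum.Support.NE3TangentCovariantTower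
import Summits.QuantumFields.BalabanUV.T4Continuum.Support.NE3SmoothLiftCurl
import HarnessLib

/-!
# NE7FlatSliceStraightReduction — row NE7 (node U5), the (A)-bill's END at the trivial flat datum: THE SLICE SOLVER LETTER `G♭` ON THE END's
# SLICE `ker (Tcoarse L)^[j]` FOLLOWS FROM THE SAME LETTER ON BAŁABAN's STRAIGHT SLICE `ker (Qcoarse L)^[j]`, AT THE COST OF THE FACTOR
# `1 + 2d·C_fr(d, L)` — UNIFORMLY IN `j` AND IN THE VOLUME (the tree-contour frames of B7's average are priced out of the (A)-bill)

Lineage `b2b-balaban-t4-ne7-p2` (CRUX PROVER NE7 #2, co-owner of row NE7), generation 84; companion of (137) `NE7FlatSliceSourceDuality`, (138)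
`NE7FlatSliceNormalForm`; memo `t4/b2b-balaban-t4-ne7-p2/g84/XLC-DOCKING-MEMO.md` §1 (file D2).  Over the NE3 swarm's flat structure of the `j`-fold linearised
average (`NE3TangentFlatStructure`: `(Tcoarse L)^[j] = (Qcoarse L)^[j] − dPot ∘ framePot L j`), its frame-killing gauge (`NE3FramePotGauge`, skew by
`NE3FrameFreeDecompositionPrep`), `NE3FramePotBound.norm_Fcoarse_le ∕ framePot_eq_sum`, `NE3BlockLineAverage.Qcoarse_apply ∕ sum_periodBox_blocks`, and the flat
Hessian = curl pairing `NE7ApeFlatSkeleton.hess_flat`.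
WHY.  The END F54 v3 asks `G♭` (`hG`) on `V = {skew, P-periodic, dirIter L j 1 · = 0}`, `dirIter L j 1 = (Tcoarse L)^[j]` = B7's (48) average with TREE contours; every
estimate in print (B5 (1.18), Prop. 1.1 ∕ 1.2) and every N-free estimate in the tree (`NE3BlockPoincareTangent.…_of_iterate_Qcoarse_eq_zero`) lives on the STRAIGHT
slice `V_s = {skew, P-periodic, (Qcoarse L)^[j] · = 0}` (`(Qcoarse L)^[j]` = the `L^j`-block LINE MEAN `NE3BlockLineAverage.iterate_Qcoarse_apply` = B5 (1.18)'s sum).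
THIS FILE: **`sliceSolver_of_straightSliceSolver`** — `G♭` on `V_s` with constant `K` ⟹ `G♭` on `V` with constant `(1 + 2d·C_fr)·K`, `C_fr = 2·dL·(2dL+1)^d`
(`d ≥ 2`, `L ≥ 2`, `(L^j)^d ≥ 2`), FOR EVERY `j` AND EVERY VOLUME `N`: the XL(c) driver may be proved on Bałaban's straight constraint; the frames (the calc
lane's G13a object) cost a `j`-free constant.
HOW ([folklore]).  (1) SOLUTION TRANSPORT `V → V ∩ V_s` is free: `X′ = X + dPot (frameKill L j X)` (`iterate_Qcoarse_add_frameKill`), same flat curl (`curlAt_flat_dPot`)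
and Hessian functional (`hess_flat_dPot`).  (2) TEST TRANSPORT `V_s → V`: `Y = Y_s + dPot (cornerLift (L^j) (framePot L j Y_s))` (the CORNER-SUPPORTED lift, §2),
so `(Tcoarse L)^[j] Y = −dPot F + dPot F = 0`; its cost `‖dPot (cornerLift …)‖_{ℓ¹} ≤ 2d·Σ_z ‖framePot L j Y_s z‖` (`dirL1_dPot_cornerLift_le`) is paid by
**`sum_norm_framePot_le`**: `Σ_{z∈periodBox N} ‖framePot L j Y z‖ ≤ C_fr·‖Y‖_{ℓ¹(periodBox (L^j N))}` — the `ℓ¹` companion of the swarm's `ℓ²` frame bound, valid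
already for `d ≥ 2` because the straight average CONTRACTS `ℓ¹` by `L^{1−d}` per level (**`dirL1_Qcoarse_le`**) and one frame term costs `dL(2dL+1)^d`
(`norm_Fcoarse_le` + box multiplicity `sum_periodBox_box_le`); geometric sum `≤ 2`.  (3) assemble.
HONEST FRAMING (page 1): [folklore] lattice bookkeeping at the FLAT configuration; crude but `j`- and `N`-free constant; NO Green's-function estimate is proved — the
straight letter `hS` is a DISPLAYED HYPOTHESIS (the XL(c) content, PRICING-NE7 v64: critical, unprinted ∕ unproved); nothing of Bałaban's asserted; NOT (APE), NOT
ONE-STEP, NOT NE7; spine 0∕9; finite T⁴ rung (B)+1 — NOT infinite volume, NOT mass gap, NOT Clay.  Continuum YM on T⁴ ⇐ BetaPertH ∧ nine spine estimates (0/9 proved);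
BetaPertH ⇐ (D1) ∧ (D4) ∧ CAP+tail; G-an2-4 gates asym, D1 and NE2/3/4.
-/

set_option autoImplicit false

open scoped BigOperators Matrix Matrix.Norms.L2Operator
open NormedSpace Finset

namespace Summit.QuantumFields.BalabanUV.T4Continuum.NE7FlatSliceStraightReduction

open Literature.MathematicalPhysics.QuantumFieldTheory.Balaban1983to89
open B7Prop1Explicit B7Prop2Explicit B7Prop3Flat UnitaryModel
open T4AveragingDeficitWall hiding Site Plane Plaq Bond
open T4AveragingDeficitWallBoundary (periodBox mem_periodBox card_periodBox sum_periodBox_shift)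
open AveragingDeficitPeriodicCounting (IsPeriodicDir sum_periodBox_box_le)
open MinimalActionLevels (perWin)
open BlockAveragePushDirSplit (flat)
open SmoothRefineNeutral (Tcoarse)
open SkeletonLattice (cdiv cdiv_eq_of_repr)
open NE3HessForm (hess)
open NE3TangentCovariantTower (dirIter dirIter_flat)
open NE3EnergyHessBilin (hessBilin hessBilin_apply curlAt_add)
open NE3SmoothLiftCurl (curlAt_flat_eq)
open NE3TangentNoGoWords (dPot)
open NE3TangentFlatStructure (Qcoarse Fcoarse framePot iterate_Tcoarse_eq' iterate_Qcoarse_add_period dPot_add)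
open NE3BlockLineAverage (Qcoarse_apply sum_periodBox_blocks)
open NE3FramePotGauge (frameKill iterate_Tcoarse_dPot iterate_Tcoarse_add frameKill_add_period iterate_Qcoarse_add_frameKill)
open NE3FrameFreeDecompositionPrep (framePot_mem_skewAdjoint frameKill_mem_skewAdjoint)
open NE3FramePotBound (framePot_eq_sum norm_Fcoarse_le geom_sum_le_inv)
open NE3BlockPoincareCore (sum_rotate3)

noncomputable section

variable {d : ℕ} {n : Type*} [Fintype n] [DecidableEq n]

local notation "𝕄" => Matrix n n ℂ

/-! ## §1 The straight average contracts `ℓ¹` by `L^{1−d}`; the `ℓ¹` frame bound -/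

/-- Reindexing a period box along the dilation `z ↦ M•z`: a sum of non-negative terms over the corners is at most the sum over the big box. [folklore] -/
theorem sum_periodBox_smul_le {M N : ℕ} (hM : 1 ≤ M) {f : Site d → ℝ} (hf : ∀ w, 0 ≤ f w) :
    ∑ z ∈ periodBox (d := d) N, f ((M : ℤ) • z) ≤ ∑ w ∈ periodBox (d := d) (M * N), f w := by
  have hM0 : (0 : ℤ) < M := by exact_mod_cast hM
  have hinj : Set.InjOn (fun z : Site d => (M : ℤ) • z) (periodBox (d := d) N) := fun z _ z' _ h => funext fun i => by
    have := congr_fun h i; simp only [Pi.smul_apply, smul_eq_mul] at this; exact mul_left_cancel₀ hM0.ne' this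
  rw [← Finset.sum_image hinj]
  refine Finset.sum_le_sum_of_subset_of_nonneg (fun w hw => ?_) fun w _ _ => hf w
  obtain ⟨z, hz, rfl⟩ := Finset.mem_image.mp hw
  rw [mem_periodBox] at hz ⊢
  exact fun κ => by simp only [Pi.smul_apply, smul_eq_mul, Nat.cast_mul]; exact ⟨mul_nonneg hM0.le (hz κ).1, mul_lt_mul_of_pos_left (hz κ).2 hM0⟩

/-- One direction of the contraction: `Σ_{z∈periodBox P} ‖Qcoarse L W z κ‖ ≤ L·L^{−d}·Σ_{w∈periodBox (L·P)} ‖W w κ‖` for an `(L·P)`-periodic `W`. [folklore] -/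
theorem sum_norm_Qcoarse_dir_le {L : ℕ} (hL : 1 ≤ L) {P : ℕ} (hP : 1 ≤ P) {W : Site d → Fin d → 𝕄}
    (hW : ∀ (y : Site d) (τ μ : Fin d), W (y + ((L * P : ℕ) : ℤ) • e τ) μ = W y μ) (κ : Fin d) :
    ∑ z ∈ periodBox (d := d) P, ‖Qcoarse L W z κ‖ ≤ (((L : ℝ) ^ d)⁻¹ * L) * ∑ w ∈ periodBox (d := d) (L * P), ‖W w κ‖ := by
  have hLP : 1 ≤ L * P := hP.trans (Nat.le_mul_of_pos_left P (by omega))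
  calc ∑ z ∈ periodBox (d := d) P, ‖Qcoarse L W z κ‖
      ≤ ∑ z ∈ periodBox (d := d) P, ((L : ℝ) ^ d)⁻¹ *
          ∑ v ∈ periodBox (d := d) L, ∑ i ∈ Finset.range L, ‖W ((L : ℤ) • z + v + (i : ℤ) • e κ) κ‖ := by
        refine Finset.sum_le_sum fun z _ => ?_
        rw [Qcoarse_apply, norm_smul, norm_inv, norm_pow, Real.norm_natCast]
        gcongr
        exact (norm_sum_le _ _).trans (Finset.sum_le_sum fun v _ => norm_sum_le _ _)
    _ = ((L : ℝ) ^ d)⁻¹ * ∑ i ∈ Finset.range L,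
          ∑ z ∈ periodBox (d := d) P, ∑ v ∈ periodBox (d := d) L, ‖W ((L : ℤ) • z + v + (i : ℤ) • e κ) κ‖ := by
        rw [← Finset.mul_sum]
        congr 1
        exact sum_rotate3 (periodBox (d := d) P) (periodBox (d := d) L) (Finset.range L)
          (fun z v i => ‖W ((L : ℤ) • z + v + (i : ℤ) • e κ) κ‖)
    _ = ((L : ℝ) ^ d)⁻¹ * ∑ i ∈ Finset.range L, ∑ w ∈ periodBox (d := d) (L * P), ‖W w κ‖ := by
        congr 1
        refine Finset.sum_congr rfl fun i _ => ?_
        rw [sum_periodBox_blocks L P hL (fun w => ‖W (w + (i : ℤ) • e κ) κ‖)]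
        refine sum_periodBox_shift (L * P) hLP (g := fun w => ‖W w κ‖) ?_ ((i : ℤ) • e κ)
        intro x τ
        show ‖W (x + ((L * P : ℕ) : ℤ) • e τ) κ‖ = ‖W x κ‖
        rw [hW]
    _ = (((L : ℝ) ^ d)⁻¹ * L) * ∑ w ∈ periodBox (d := d) (L * P), ‖W w κ‖ := by
        rw [Finset.sum_const, Finset.card_range, nsmul_eq_mul, mul_assoc]

/-- **THE STRAIGHT AVERAGE CONTRACTS `ℓ¹` BY `L^{1−d}`**: for an `(L·P)`-periodic `W`,
`‖Qcoarse L W‖_{ℓ¹(periodBox P)} ≤ L·L^{−d}·‖W‖_{ℓ¹(periodBox (L·P))}` (every fine bond lies on exactly `L` of the averaged block lines). [folklore] -/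
theorem dirL1_Qcoarse_le {L : ℕ} (hL : 1 ≤ L) {P : ℕ} (hP : 1 ≤ P) {W : Site d → Fin d → 𝕄}
    (hW : ∀ (y : Site d) (τ μ : Fin d), W (y + ((L * P : ℕ) : ℤ) • e τ) μ = W y μ) :
    dirL1 (Qcoarse L W) (periodBox (d := d) P) ≤ (((L : ℝ) ^ d)⁻¹ * L) * dirL1 W (periodBox (d := d) (L * P)) := by
  unfold dirL1
  rw [Finset.sum_comm, Finset.sum_comm (s := periodBox (d := d) (L * P)), Finset.mul_sum]
  exact Finset.sum_le_sum fun κ _ => sum_norm_Qcoarse_dir_le hL hP hW κ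

/-- The iterated contraction: `‖(Qcoarse L)^[m] W‖_{ℓ¹(periodBox P)} ≤ (L·L^{−d})^m·‖W‖_{ℓ¹(periodBox (L^m·P))}`. [folklore] -/
theorem dirL1_iterate_Qcoarse_le {L : ℕ} (hL : 1 ≤ L) :
    ∀ (m : ℕ) {P : ℕ}, 1 ≤ P → ∀ {W : Site d → Fin d → 𝕄},
      (∀ (y : Site d) (τ μ : Fin d), W (y + ((L ^ m * P : ℕ) : ℤ) • e τ) μ = W y μ) →
      dirL1 ((Qcoarse L)^[m] W) (periodBox (d := d) P) ≤ (((L : ℝ) ^ d)⁻¹ * L) ^ m * dirL1 W (periodBox (d := d) (L ^ m * P))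
  | 0, P, _, W, _ => by simp
  | m + 1, P, hP, W, hW => by
      have hW' : ∀ (y : Site d) (τ μ : Fin d), W (y + ((L ^ m * (L * P) : ℕ) : ℤ) • e τ) μ = W y μ := fun y τ μ => by
        rw [show L ^ m * (L * P) = L ^ (m + 1) * P by ring]; exact hW y τ μ
      have hper : ∀ (y : Site d) (τ μ : Fin d), (Qcoarse L)^[m] W (y + ((L * P : ℕ) : ℤ) • e τ) μ = (Qcoarse L)^[m] W y μ := fun y τ μ =>
        iterate_Qcoarse_add_period L m W (P := ((L * P : ℕ) : ℤ)) (fun y' τ' μ' => by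
          rw [show ((L : ℤ) ^ m * ((L * P : ℕ) : ℤ)) = ((L ^ m * (L * P) : ℕ) : ℤ) by push_cast; ring]; exact hW' y' τ' μ') y τ μ
      rw [Function.iterate_succ_apply', pow_succ, show L ^ (m + 1) * P = L ^ m * (L * P) by ring]
      calc dirL1 (Qcoarse L ((Qcoarse L)^[m] W)) (periodBox (d := d) P)
          ≤ (((L : ℝ) ^ d)⁻¹ * L) * dirL1 ((Qcoarse L)^[m] W) (periodBox (d := d) (L * P)) := dirL1_Qcoarse_le hL hP hper
        _ ≤ (((L : ℝ) ^ d)⁻¹ * L) * ((((L : ℝ) ^ d)⁻¹ * L) ^ m * dirL1 W (periodBox (d := d) (L ^ m * (L * P)))) := by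
            gcongr
            exact dirL1_iterate_Qcoarse_le hL m (hP.trans (Nat.le_mul_of_pos_left P (by omega))) hW'
        _ = _ := by ring

/-- The crude frame constant `C_fr(d, L) = 2·dL·(2dL+1)^d`. [folklore] -/
def Cfr (d L : ℕ) : ℝ := 2 * ((d * L : ℝ) * (2 * (d * L) + 1) ^ d)

/-- **THE `ℓ¹` FRAME BOUND, `j`- AND `N`-FREE** (`d ≥ 2`, `L ≥ 2`): for an `(L^k·N)`-periodic `Y`,
`Σ_{z∈periodBox N} ‖framePot L k Y z‖ ≤ C_fr(d,L)·‖Y‖_{ℓ¹(periodBox (L^k·N))}` — the level-`m` frame is read at dilated corners (`sum_periodBox_smul_le`), one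
frame term costs `dL·(2dL+1)^d` in `ℓ¹` (`norm_Fcoarse_le` + box multiplicity), and the `m`-fold straight average in front of it contracts `ℓ¹` by
`(L^{1−d})^m ≤ 2^{−m}`. [folklore] -/
theorem sum_norm_framePot_le (hd : 2 ≤ d) {L : ℕ} (hL : 2 ≤ L) {N : ℕ} (hN : 1 ≤ N) (k : ℕ) {Y : Site d → Fin d → 𝕄}
    (hY : ∀ (y : Site d) (τ μ : Fin d), Y (y + ((L ^ k * N : ℕ) : ℤ) • e τ) μ = Y y μ) :
    ∑ z ∈ periodBox (d := d) N, ‖framePot L k Y z‖ ≤ Cfr d L * dirL1 Y (periodBox (d := d) (L ^ k * N)) := by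
  have hL1 : 1 ≤ L := by omega
  have hL0 : (0 : ℝ) < L := by exact_mod_cast (by omega : 0 < L)
  set ρ : ℝ := ((L : ℝ) ^ d)⁻¹ * L with hρ
  set D : ℝ := (d * L : ℝ) * (2 * (d * L) + 1) ^ d with hD
  have hD0 : 0 ≤ D := by rw [hD]; positivity
  have hρ0 : 0 ≤ ρ := by rw [hρ]; positivity
  have hρ1 : ρ ≤ 1 / 2 := by -- ρ = L^{1-d} ≤ L^{-1} ≤ 1/2
    obtain ⟨d', rfl⟩ : ∃ d', d = d' + 2 := ⟨d - 2, by omega⟩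
    rw [hρ, pow_succ, mul_inv, mul_assoc, inv_mul_cancel₀ hL0.ne', mul_one]
    calc ((L : ℝ) ^ (d' + 1))⁻¹ ≤ ((L : ℝ) ^ 1)⁻¹ := by gcongr; exacts [by exact_mod_cast hL1, by omega]
      _ ≤ 1 / 2 := by rw [pow_one, one_div]; gcongr; exact_mod_cast hL
  have hY1 : 0 ≤ dirL1 Y (periodBox (d := d) (L ^ k * N)) := Finset.sum_nonneg fun _ _ => Finset.sum_nonneg fun _ _ => norm_nonneg _
  -- one level `m < k`
  have hterm : ∀ m < k, ∑ z ∈ periodBox (d := d) N, ‖Fcoarse L ((Qcoarse L)^[m] Y) (((L : ℤ) ^ (k - 1 - m)) • z)‖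
      ≤ D * ρ ^ m * dirL1 Y (periodBox (d := d) (L ^ k * N)) := by
    intro m hm
    set P' : ℕ := L ^ (k - 1 - m) * N with hP'
    have hP'1 : 1 ≤ P' := by rw [hP']; exact hN.trans (Nat.le_mul_of_pos_left N (Nat.pow_pos (by omega)))
    have hkm : L ^ m * (L * P') = L ^ k * N := by
      rw [hP', ← mul_assoc, ← pow_succ, ← mul_assoc, ← pow_add]; congr 2; omega
    have hWper : ∀ (y : Site d) (τ μ : Fin d), (Qcoarse L)^[m] Y (y + ((L * P' : ℕ) : ℤ) • e τ) μ = (Qcoarse L)^[m] Y y μ := fun y τ μ =>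
      iterate_Qcoarse_add_period L m Y (P := ((L * P' : ℕ) : ℤ)) (fun y' τ' μ' => by
        rw [show ((L : ℤ) ^ m * ((L * P' : ℕ) : ℤ)) = ((L ^ k * N : ℕ) : ℤ) by rw [← hkm]; push_cast; ring]; exact hY y' τ' μ') y τ μ
    have hg0 : ∀ x : Site d, 0 ≤ ∑ κ : Fin d, ‖(Qcoarse L)^[m] Y x κ‖ := fun x => Finset.sum_nonneg fun _ _ => norm_nonneg _
    calc ∑ z ∈ periodBox (d := d) N, ‖Fcoarse L ((Qcoarse L)^[m] Y) (((L : ℤ) ^ (k - 1 - m)) • z)‖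
        ≤ ∑ w ∈ periodBox (d := d) P', ‖Fcoarse L ((Qcoarse L)^[m] Y) w‖ := by
          simpa only [Nat.cast_pow] using sum_periodBox_smul_le (d := d) (M := L ^ (k - 1 - m)) (N := N) (Nat.one_le_pow _ _ hL1)
            (f := fun w => ‖Fcoarse L ((Qcoarse L)^[m] Y) w‖) (fun _ => norm_nonneg _)
      _ ≤ ∑ w ∈ periodBox (d := d) P', (d * L : ℝ) * dirL1 ((Qcoarse L)^[m] Y) (box (d * L) ((L : ℤ) • w)) :=
          Finset.sum_le_sum fun w _ => norm_Fcoarse_le hL1 _ w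
      _ = (d * L : ℝ) * ∑ w ∈ periodBox (d := d) P', ∑ x ∈ box (d * L) ((L : ℤ) • w), ∑ κ : Fin d, ‖(Qcoarse L)^[m] Y x κ‖ := by
          rw [Finset.mul_sum]; rfl
      _ ≤ (d * L : ℝ) * ((2 * (d * L) + 1) ^ d * ∑ x ∈ periodBox (d := d) (L * P'), ∑ κ : Fin d, ‖(Qcoarse L)^[m] Y x κ‖) := by
          gcongr
          exact_mod_cast sum_periodBox_box_le L P' hL1 hP'1 (d * L) hg0 (fun x κ => by
            show ∑ κ' : Fin d, ‖(Qcoarse L)^[m] Y (x + ((L * P' : ℕ) : ℤ) • e κ) κ'‖ = ∑ κ' : Fin d, ‖(Qcoarse L)^[m] Y x κ'‖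
            exact Finset.sum_congr rfl fun κ' _ => by rw [hWper])
      _ = D * dirL1 ((Qcoarse L)^[m] Y) (periodBox (d := d) (L * P')) := by simp only [hD, dirL1]; ring
      _ ≤ D * (ρ ^ m * dirL1 Y (periodBox (d := d) (L ^ m * (L * P')))) := by
          gcongr
          exact dirL1_iterate_Qcoarse_le hL1 m (hP'1.trans (Nat.le_mul_of_pos_left P' (by omega)))
            (fun y τ μ => by rw [hkm]; exact hY y τ μ)
      _ = D * ρ ^ m * dirL1 Y (periodBox (d := d) (L ^ k * N)) := by rw [hkm]; ring
  -- sum over the levels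
  calc ∑ z ∈ periodBox (d := d) N, ‖framePot L k Y z‖
      = ∑ z ∈ periodBox (d := d) N, ‖∑ m ∈ Finset.range k, Fcoarse L ((Qcoarse L)^[m] Y) (((L : ℤ) ^ (k - 1 - m)) • z)‖ :=
        Finset.sum_congr rfl fun z _ => by rw [framePot_eq_sum]
    _ ≤ ∑ z ∈ periodBox (d := d) N, ∑ m ∈ Finset.range k, ‖Fcoarse L ((Qcoarse L)^[m] Y) (((L : ℤ) ^ (k - 1 - m)) • z)‖ :=
        Finset.sum_le_sum fun z _ => norm_sum_le _ _
    _ = ∑ m ∈ Finset.range k, ∑ z ∈ periodBox (d := d) N, ‖Fcoarse L ((Qcoarse L)^[m] Y) (((L : ℤ) ^ (k - 1 - m)) • z)‖ := Finset.sum_comm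
    _ ≤ ∑ m ∈ Finset.range k, D * ρ ^ m * dirL1 Y (periodBox (d := d) (L ^ k * N)) :=
        Finset.sum_le_sum fun m hm => hterm m (Finset.mem_range.mp hm)
    _ = D * (∑ m ∈ Finset.range k, ρ ^ m) * dirL1 Y (periodBox (d := d) (L ^ k * N)) := by
        rw [Finset.mul_sum, Finset.sum_mul]
    _ ≤ D * 2 * dirL1 Y (periodBox (d := d) (L ^ k * N)) := by
        gcongr
        calc ∑ m ∈ Finset.range k, ρ ^ m ≤ 1 / (1 - ρ) := geom_sum_le_inv hρ0 (by linarith) k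
          _ ≤ 2 := by rw [div_le_iff₀ (by linarith)]; linarith
    _ = Cfr d L * dirL1 Y (periodBox (d := d) (L ^ k * N)) := by rw [Cfr, hD]; ring

/-! ## §2 The corner-supported lift of a coarse potential -/

/-- **THE CORNER LIFT**: `cornerLift M F x = F (x∕M)` at the corners `x ∈ M·ℤ^d` and `0` elsewhere (the complement of the swarm's `cornerGauge`). [folklore] -/
def cornerLift (M : ℕ) (F : Site d → 𝕄) (x : Site d) : 𝕄 :=
  if x = (M : ℤ) • cdiv M x then F (cdiv M x) else 0

omit [Fintype n] [DecidableEq n] in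
/-- At a corner: `cornerLift M F (M•w) = F w` (`M ≥ 1`). [folklore] -/
theorem cornerLift_corner {M : ℕ} (hM : 1 ≤ M) (F : Site d → 𝕄) (w : Site d) : cornerLift M F ((M : ℤ) • w) = F w := by
  have hc : cdiv M ((M : ℤ) • w) = w :=
    cdiv_eq_of_repr (q := 0) (by simp) (fun _ => le_rfl) (fun _ => by simp only [Pi.zero_apply]; exact_mod_cast (by omega : 0 < M))
  unfold cornerLift; rw [hc, if_pos rfl]

omit [Fintype n] [DecidableEq n] in
/-- Off the corner of its block the lift vanishes: for `v ∈ [0,M)^d`, `v ≠ 0`, `cornerLift M F (M•z + v) = 0`. [folklore] -/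
theorem cornerLift_off_corner (M : ℕ) (F : Site d → 𝕄) (z : Site d) {v : Site d} (hv : v ∈ periodBox (d := d) M) (hv0 : v ≠ 0) :
    cornerLift M F ((M : ℤ) • z + v) = 0 := by
  have hb := mem_periodBox.mp hv
  have hc : cdiv M ((M : ℤ) • z + v) = z := cdiv_eq_of_repr rfl (fun i => (hb i).1) (fun i => (hb i).2)
  have hne : (M : ℤ) • z + v ≠ (M : ℤ) • cdiv M ((M : ℤ) • z + v) := by rw [hc]; intro h; exact hv0 (by simpa using h)
  unfold cornerLift; rw [if_neg hne]

omit [Fintype n] [DecidableEq n] in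
/-- The corner lift of a `P`-periodic coarse potential is `(M·P)`-periodic (`M ≥ 1`). [folklore] -/
theorem cornerLift_add_period {M : ℕ} (hM : 1 ≤ M) {F : Site d → 𝕄} {P : ℤ} (hF : ∀ (z : Site d) (τ : Fin d), F (z + P • e τ) = F z)
    (x : Site d) (τ : Fin d) : cornerLift M F (x + ((M : ℤ) * P) • e τ) = cornerLift M F x := by
  have hc : cdiv M (x + ((M : ℤ) * P) • e τ) = cdiv M x + P • e τ := SkeletonLattice.cdiv_add_period hM P x τ
  have hiff : (x + ((M : ℤ) * P) • e τ = (M : ℤ) • (cdiv M x + P • e τ)) ↔ (x = (M : ℤ) • cdiv M x) := by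
    rw [smul_add, smul_smul]
    exact ⟨fun h => add_right_cancel h, fun h => by rw [← h]⟩
  unfold cornerLift
  rw [hc, hF]
  by_cases hx : x = (M : ℤ) • cdiv M x
  · rw [if_pos hx, if_pos (hiff.mpr hx)]
  · rw [if_neg hx, if_neg (fun h => hx (hiff.mp h))]

omit [Fintype n] [DecidableEq n] in
/-- The corner lift of a skew potential is skew. [folklore] -/
theorem cornerLift_mem_skewAdjoint (M : ℕ) {F : Site d → 𝕄} (hF : ∀ z, F z ∈ skewAdjoint 𝕄) (x : Site d) :
    cornerLift M F x ∈ skewAdjoint 𝕄 := by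
  unfold cornerLift
  split_ifs
  · exact hF _
  · exact (skewAdjoint 𝕄).zero_mem

/-- **The `ℓ¹` cost of the corner lift**: `‖dPot (cornerLift M F)‖_{ℓ¹(periodBox (M·N))} ≤ 2d·Σ_{z∈periodBox N} ‖F z‖` for an `N`-periodic `F` (each corner
touches `2d` bonds). [folklore] -/
theorem dirL1_dPot_cornerLift_le {M N : ℕ} (hM : 1 ≤ M) (hN : 1 ≤ N) {F : Site d → 𝕄}
    (hF : ∀ (z : Site d) (τ : Fin d), F (z + (N : ℤ) • e τ) = F z) :
    dirL1 (dPot (cornerLift M F)) (periodBox (d := d) (M * N)) ≤ 2 * d * ∑ z ∈ periodBox (d := d) N, ‖F z‖ := by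
  have hMN : 1 ≤ M * N := hN.trans (Nat.le_mul_of_pos_left N (by omega))
  have hper : ∀ (x : Site d) (κ : Fin d), ‖cornerLift M F (x + ((M * N : ℕ) : ℤ) • e κ)‖ = ‖cornerLift M F x‖ := by
    intro x κ
    rw [show ((M * N : ℕ) : ℤ) = (M : ℤ) * (N : ℤ) by push_cast; ring, cornerLift_add_period hM hF]
  -- the sum of `‖cornerLift‖` over the big box is the sum of `‖F‖` over the corners
  have hsum : ∑ x ∈ periodBox (d := d) (M * N), ‖cornerLift M F x‖ = ∑ z ∈ periodBox (d := d) N, ‖F z‖ := by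
    rw [← sum_periodBox_blocks M N hM (fun x => ‖cornerLift M F x‖)]
    refine Finset.sum_congr rfl fun z _ => ?_
    rw [Finset.sum_eq_single_of_mem (0 : Site d)
      (mem_periodBox.mpr fun κ => ⟨le_rfl, by simp only [Pi.zero_apply]; exact_mod_cast (by omega : 0 < M)⟩)
      (fun v hv hv0 => by rw [cornerLift_off_corner M F z hv hv0, norm_zero])]
    rw [add_zero, cornerLift_corner hM]
  unfold dirL1
  calc ∑ x ∈ periodBox (d := d) (M * N), ∑ κ : Fin d, ‖dPot (cornerLift M F) x κ‖
      ≤ ∑ x ∈ periodBox (d := d) (M * N), ∑ κ : Fin d, (‖cornerLift M F (x + e κ)‖ + ‖cornerLift M F x‖) :=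
        Finset.sum_le_sum fun x _ => Finset.sum_le_sum fun κ _ => norm_sub_le _ _
    _ = ∑ κ : Fin d, (∑ x ∈ periodBox (d := d) (M * N), ‖cornerLift M F (x + e κ)‖ + ∑ x ∈ periodBox (d := d) (M * N), ‖cornerLift M F x‖) := by
        rw [Finset.sum_comm]; simp only [Finset.sum_add_distrib]
    _ = ∑ _κ : Fin d, 2 * ∑ z ∈ periodBox (d := d) N, ‖F z‖ := by
        refine Finset.sum_congr rfl fun κ _ => ?_
        rw [sum_periodBox_shift (M * N) hMN (g := fun x => ‖cornerLift M F x‖) hper (e κ), hsum]; ring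
    _ = 2 * d * ∑ z ∈ periodBox (d := d) N, ‖F z‖ := by
        rw [Finset.sum_const, Finset.card_univ, Fintype.card_fin, nsmul_eq_mul]; ring

/-- **THE `j`-FOLD CONTOUR AVERAGE OF THE LIFTED COBOUNDARY IS THE COARSE COBOUNDARY**: `(Tcoarse L)^[j] (dPot (cornerLift (L^j) F)) = dPot F`
(`iterate_Tcoarse_dPot`: only the corner values are read). [folklore] -/
theorem iterate_Tcoarse_dPot_cornerLift {L : ℕ} (hL : 1 ≤ L) (j : ℕ) (F : Site d → 𝕄) :
    (Tcoarse L)^[j] (dPot (cornerLift (L ^ j) F)) = dPot F := by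
  rw [iterate_Tcoarse_dPot hL]
  funext z κ
  have hc : ∀ w : Site d, cornerLift (L ^ j) F (((L : ℤ) ^ j) • w) = F w := fun w => by
    rw [show ((L : ℤ) ^ j) = ((L ^ j : ℕ) : ℤ) by push_cast; ring]; exact cornerLift_corner (Nat.one_le_pow _ _ hL) F w
  simp only [dPot, hc]

/-! ## §3 Flat gauge invariance of the curl and of the Hessian -/

omit [DecidableEq n] in
/-- The flat curl of a coboundary vanishes. [folklore] -/
theorem curlAt_flat_dPot [DecidableEq n] (Φ : Site d → 𝕄) (z : Site d) (μ ν : Fin d) :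
    curlAt (flat (d := d) (n := n)) (dPot Φ) z μ ν = 0 := by
  rw [curlAt_flat_eq]
  simp only [dPot, add_right_comm z (e μ) (e ν)]
  abel

/-- The flat Hessian vanishes on a coboundary in either slot (`hess_flat`: the flat Hessian is the curl pairing). [folklore] -/
theorem hess_flat_dPot (Φ : Site d → 𝕄) (X : Site d → Fin d → 𝕄) (W : Finset (T4AveragingDeficitWall.Plaq d)) :
    hess (flat (d := d) (n := n)) (dPot Φ) X W = 0 ∧ hess (flat (d := d) (n := n)) X (dPot Φ) W = 0 := by
  rw [NE7ApeFlatSkeleton.hess_flat (flat_mem_classes (d := d) (n := n) le_rfl).2, NE7ApeFlatSkeleton.hess_flat (flat_mem_classes (d := d) (n := n) le_rfl).2]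
  simp only [curl, curlAt_flat_dPot, mul_zero, zero_mul, Finset.sum_const_zero, neg_zero, UnitaryModel.nReTr, Matrix.trace_zero,
    Complex.zero_re, zero_div, and_self]

/-! ## §4 THE REDUCTION: `G♭` on the straight slice ⟹ `G♭` on the END's slice, constant `(1 + 2d·C_fr)·K`, uniformly in `j` and `N` -/

/-- **`sliceSolver_of_straightSliceSolver`.**  HYPOTHESIS `hS` (DISPLAYED; the XL(c) content on BAŁABAN's straight constraint): the letter `G♭` with constant `K`
for solutions AND tests in `{skew, P-periodic, (Qcoarse L)^[j] · = 0}`.  CONCLUSION: the END's letter `hG′` on `{skew, P-periodic, dirIter L j 1 · = 0}` EXACTLY AS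
TYPED in F54 v3 ∕ (135) §6 ∕ (136) ∕ (137), with `K_G = (1 + 2d·C_fr(d,L))·K` — every `j`, every `N` (`P = L^j·N`, `d ≥ 2`, `L ≥ 2`, `(L^j)^d ≥ 2`). [folklore] -/
theorem sliceSolver_of_straightSliceSolver (hd : 2 ≤ d) {L : ℕ} (hL : 2 ≤ L) {j N : ℕ} (hN : 1 ≤ N) (hMd : 2 ≤ (L ^ j) ^ d) {K : ℝ}
    (hS : ∀ X : Site d → Fin d → 𝕄, IsSkewDir X → IsPeriodicDir X ((L ^ j * N : ℕ) : ℤ) → (Qcoarse L)^[j] X = 0 → ∀ g : ℝ, 0 ≤ g →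
      (∀ Y : Site d → Fin d → 𝕄, IsSkewDir Y → IsPeriodicDir Y ((L ^ j * N : ℕ) : ℤ) → (Qcoarse L)^[j] Y = 0 →
        |hess (flat (d := d) (n := n)) X Y (perWin d (L ^ j * N))| ≤ g * dirL1 Y (periodBox (d := d) (L ^ j * N))) →
      ∀ (z : Site d) (μ ν : Fin d), μ ≠ ν → ‖curlAt (flat (d := d) (n := n)) X z μ ν‖ ≤ K * g) :
    ∀ X : Site d → Fin d → 𝕄, IsSkewDir X → IsPeriodicDir X ((L ^ j * N : ℕ) : ℤ) → dirIter L j (flat (d := d) (n := n)) X = 0 → ∀ g : ℝ, 0 ≤ g →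
      (∀ Y : Site d → Fin d → 𝕄, IsSkewDir Y → IsPeriodicDir Y ((L ^ j * N : ℕ) : ℤ) → dirIter L j (flat (d := d) (n := n)) Y = 0 →
        |hess (flat (d := d) (n := n)) X Y (perWin d (L ^ j * N))| ≤ g * dirL1 Y (periodBox (d := d) (L ^ j * N))) →
      ∀ (z : Site d) (μ ν : Fin d), μ ≠ ν →
        ‖curlAt (flat (d := d) (n := n)) X z μ ν‖ ≤ ((1 + 2 * d * Cfr d L) * K) * g := by
  have hL1 : 1 ≤ L := by omega
  set P : ℕ := L ^ j * N with hP
  have hcast : ((L : ℤ) ^ j * (N : ℤ)) = ((P : ℕ) : ℤ) := by rw [hP]; push_cast; ring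
  intro X hXs hXP hXT g hg hfun z μ ν hμν
  have hXP' : ∀ (y : Site d) (τ μ' : Fin d), X (y + ((L : ℤ) ^ j * (N : ℤ)) • e τ) μ' = X y μ' := fun y τ μ' => by rw [hcast]; exact hXP y τ μ'
  -- (1) the frame-free representative of `X`
  have hXT' : (Tcoarse L)^[j] X = 0 := by rw [← dirIter_flat hL1]; exact hXT
  set X' : Site d → Fin d → 𝕄 := fun y μ' => X y μ' + dPot (frameKill L j X) y μ' with hX'
  have hX's : IsSkewDir X' := fun y μ' =>
    (skewAdjoint 𝕄).add_mem (hXs y μ') ((skewAdjoint 𝕄).sub_mem (frameKill_mem_skewAdjoint L j hXs _) (frameKill_mem_skewAdjoint L j hXs _))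
  have hX'P : IsPeriodicDir X' ((P : ℕ) : ℤ) := by
    intro y τ μ'
    show X (y + (P : ℤ) • e τ) μ' + dPot (frameKill L j X) (y + (P : ℤ) • e τ) μ' = X y μ' + dPot (frameKill L j X) y μ'
    rw [hXP]; congr 1; simp only [dPot]
    rw [add_right_comm, ← hcast, frameKill_add_period hL1 j hXP', frameKill_add_period hL1 j hXP']
  have hX'Q : (Qcoarse L)^[j] X' = 0 := iterate_Qcoarse_add_frameKill hL1 hMd X hXT'
  -- (2) the functional bound for `X'` on the straight slice, with `g' = (1 + 2d·C_fr)·g`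
  have hfun' : ∀ Y : Site d → Fin d → 𝕄, IsSkewDir Y → IsPeriodicDir Y ((P : ℕ) : ℤ) → (Qcoarse L)^[j] Y = 0 →
      |hess (flat (d := d) (n := n)) X' Y (perWin d P)| ≤ ((1 + 2 * d * Cfr d L) * g) * dirL1 Y (periodBox (d := d) P) := by
    intro Ys hYs hYP hYQ
    have hYP' : ∀ (y : Site d) (τ μ' : Fin d), Ys (y + ((L ^ j * N : ℕ) : ℤ) • e τ) μ' = Ys y μ' := hYP
    set F : Site d → 𝕄 := framePot L j Ys with hF
    have hFper : ∀ (w : Site d) (τ : Fin d), F (w + (N : ℤ) • e τ) = F w := fun w τ =>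
      NE3TangentFlatStructure.framePot_add_period L j Ys (P := (N : ℤ)) (fun y τ' μ' => by rw [hcast]; exact hYP y τ' μ') w τ
    set Y : Site d → Fin d → 𝕄 := fun y μ' => Ys y μ' + dPot (cornerLift (L ^ j) F) y μ' with hY
    have hYs' : IsSkewDir Y := fun y μ' =>
      (skewAdjoint 𝕄).add_mem (hYs y μ') ((skewAdjoint 𝕄).sub_mem
        (cornerLift_mem_skewAdjoint _ (framePot_mem_skewAdjoint L j hYs) _) (cornerLift_mem_skewAdjoint _ (framePot_mem_skewAdjoint L j hYs) _))
    have hYP2 : IsPeriodicDir Y ((P : ℕ) : ℤ) := by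
      intro y τ μ'
      show Ys (y + (P : ℤ) • e τ) μ' + dPot (cornerLift (L ^ j) F) (y + (P : ℤ) • e τ) μ' = Ys y μ' + dPot (cornerLift (L ^ j) F) y μ'
      rw [hYP]; congr 1; simp only [dPot]
      rw [add_right_comm, show ((P : ℕ) : ℤ) = ((L ^ j : ℕ) : ℤ) * (N : ℤ) by rw [hP]; push_cast; ring,
        cornerLift_add_period (Nat.one_le_pow _ _ hL1) hFper, cornerLift_add_period (Nat.one_le_pow _ _ hL1) hFper]
    have hYT : dirIter L j (flat (d := d) (n := n)) Y = 0 := by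
      rw [dirIter_flat hL1, hY, iterate_Tcoarse_add, iterate_Tcoarse_dPot_cornerLift hL1, iterate_Tcoarse_eq' hL1 j Ys, hYQ]
      funext w κ
      simp only [Pi.zero_apply, zero_sub, ← hF, neg_add_cancel]
    -- `hess 1 X' Ys = hess 1 X Y`
    have hhess : hess (flat (d := d) (n := n)) X' Ys (perWin d P) = hess (flat (d := d) (n := n)) X Y (perWin d P) := by
      have e1 : X' = X + dPot (frameKill L j X) := by funext y μ'; rfl
      have e2 : Y = Ys + dPot (cornerLift (L ^ j) F) := by funext y μ'; rfl
      simp only [e1, e2, NE3EnergyHessBilin.hess_add_left, NE3EnergyHessBilin.hess_add_right, (hess_flat_dPot _ _ _).1,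
        (hess_flat_dPot _ _ _).2, add_zero]
    -- `‖Y‖₁ ≤ (1 + 2d·C_fr)·‖Ys‖₁`
    have hY1 : dirL1 Y (periodBox (d := d) P) ≤ (1 + 2 * d * Cfr d L) * dirL1 Ys (periodBox (d := d) P) := by
      have h1 : dirL1 Y (periodBox (d := d) P) ≤ dirL1 Ys (periodBox (d := d) P) + dirL1 (dPot (cornerLift (L ^ j) F)) (periodBox (d := d) P) := by
        simp only [dirL1, ← Finset.sum_add_distrib]
        exact Finset.sum_le_sum fun x _ => Finset.sum_le_sum fun κ _ => norm_add_le _ _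
      have h2 : dirL1 (dPot (cornerLift (L ^ j) F)) (periodBox (d := d) P) ≤ 2 * d * ∑ w ∈ periodBox (d := d) N, ‖F w‖ := by
        rw [hP]; exact dirL1_dPot_cornerLift_le (Nat.one_le_pow _ _ hL1) hN hFper
      have h3 : ∑ w ∈ periodBox (d := d) N, ‖F w‖ ≤ Cfr d L * dirL1 Ys (periodBox (d := d) P) := by
        rw [hF, hP]; exact sum_norm_framePot_le hd hL hN j hYP'
      nlinarith [mul_le_mul_of_nonneg_left h3 (by positivity : (0 : ℝ) ≤ 2 * d)]
    calc |hess (flat (d := d) (n := n)) X' Ys (perWin d P)| = |hess (flat (d := d) (n := n)) X Y (perWin d P)| := by rw [hhess]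
      _ ≤ g * dirL1 Y (periodBox (d := d) P) := hfun Y hYs' hYP2 hYT
      _ ≤ g * ((1 + 2 * d * Cfr d L) * dirL1 Ys (periodBox (d := d) P)) := by gcongr
      _ = ((1 + 2 * d * Cfr d L) * g) * dirL1 Ys (periodBox (d := d) P) := by ring
  -- (3) the straight letter for `X'`, and `curl X' = curl X`
  have hC0 : 0 ≤ (1 + 2 * d * Cfr d L) * g := by unfold Cfr; positivity
  have h := hS X' hX's hX'P hX'Q ((1 + 2 * d * Cfr d L) * g) hC0 hfun' z μ ν hμν
  rw [show X' = X + dPot (frameKill L j X) from funext fun y => funext fun μ' => rfl, curlAt_add, curlAt_flat_dPot, add_zero] at h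
  linarith [h]

end

end Summit.QuantumFields.BalabanUV.T4Continuum.NE7FlatSliceStraightReduction
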